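import Mathlib
import Summits.KontsevichZagierPeriods.KontsevichZagierPeriods.Theses.InverseLandau
import Literature.NumberTheory.Transcendental.KZCalculus
import Literature.NumberTheory.Transcendental.KZDirichletCharts

/-!
# `TateLifting` (stmt-KontsevichZagierPeriods-9129), line `Sketch` — stub `betaGammaTruncated`:
# the truncated Beta–Gamma change of variables (`BetaGammaTruncated`, route WeightLine, stmt-7183)

For every rational level `t` and ANY two Kontsevich–Zagier integral representations on
`ℝ² = Fin 2 → ℝ`,
`r₁ = [{x > 0, y > 0, x + y < t}, x^{-2/3} y^{-2/3}]` (the open truncated simplex) and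
`r₂ = [{0 < s < t} × (0,1), s^{-1/3} (u(1-u))^{-2/3}]` (the box of height `t`),
pinned by their domains and by their integrands ON the domains, we prove `KZ.Equivalent r₁ r₂`, i.e.
`[r₁] − [r₂] ∈ KZ.relations` (`tateLifting_betaGammaTruncated`; verbatim the open item
`BetaGammaTruncated` of route WeightLine, stmt-KontsevichZagierPeriods-7183 — the truncate-and-forget
image of the Beta–Gamma change of variables, weight `x + y = s`).

The proof is ONE change of variables (Kontsevich–Zagier rule (2), `KZ.changeOfVariablesRel`) applied to
the two GIVEN representations: the Dirichlet polar chart `Φ(s,u) = (su, s(1-u))` maps the box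
`r₂.domain = {0 < s < t} × (0,1)` injectively ONTO the truncated simplex `r₁.domain` (inverse
`s = x + y`, `u = x/(x+y)`), it is a `ℚ`-polynomial map (so `ℚ`-semialgebraic on the `ℚ`-semialgebraic
set `r₂.domain`), differentiable with `|det DΦ| = s`, and the Jacobian identity
`(su)^{-2/3} (s(1-u))^{-2/3} · s = s^{-1/3} (u(1-u))^{-2/3}` holds on the box; hence
`[r₂] − [r₁] ∈ KZ.changeOfVariablesRel ⊆ KZ.relations`. The chart is the one of
`KZ.exists_dirichletPolarChart` (Literature `KZDirichletCharts`, level `t = 1`), redone on the box of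
height `t` (`BetaGammaTruncated.exists_polarChart`). The degenerate levels `t ≤ 0` need no separate
treatment: there both domains are empty and the five clauses of the move hold vacuously / by the same
computation.

No definition is introduced. References: M. Kontsevich, D. Zagier, *Periods* (2001), §1.2 rule (2);
G. E. Andrews, R. Askey, R. Roy, *Special Functions* (1999), Thm. 1.8.1 (Dirichlet's integral).
-/

noncomputable section

open MeasureTheory Set
open Literature.NumberTheory.Transcendental

namespace Summit.KontsevichZagierPeriods.InverseLandau

namespace BetaGammaTruncated

/-- **The polar chart `Φ(s,u) = (su, s(1-u))` of the truncated simplex by the box of height `t`**: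
a polynomial map, differentiable everywhere with `det DΦ(s,u) = -s`, injective on the box
`{0 < s < t} × (0,1)` and ONTO the open truncated simplex `{x > 0, y > 0, x + y < t}`
(inverse `s = x + y`, `u = x/(x+y)`). [folklore] -/
theorem exists_polarChart (t : ℝ) :
    ∃ (Φ : (Fin 2 → ℝ) → (Fin 2 → ℝ)) (Φ' : (Fin 2 → ℝ) → (Fin 2 → ℝ) →L[ℝ] (Fin 2 → ℝ)),
      (∀ z, Φ z 0 = z 0 * z 1) ∧ (∀ z, Φ z 1 = z 0 * (1 - z 1)) ∧
      (∀ z, HasFDerivAt Φ (Φ' z) z) ∧ (∀ z, (Φ' z).det = -(z 0)) ∧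
      Set.InjOn Φ {z : Fin 2 → ℝ | 0 < z 0 ∧ z 0 < t ∧ z 1 ∈ Set.Ioo (0:ℝ) 1} ∧
      Φ '' {z : Fin 2 → ℝ | 0 < z 0 ∧ z 0 < t ∧ z 1 ∈ Set.Ioo (0:ℝ) 1} =
        {z : Fin 2 → ℝ | 0 < z 0 ∧ 0 < z 1 ∧ z 0 + z 1 < t} := by
  -- adapted from `KZ.exists_dirichletPolarChart` (Literature/NumberTheory/Transcendental/KZDirichletCharts.lean)
  set Φ : (Fin 2 → ℝ) → (Fin 2 → ℝ) := fun z => ![z 0 * z 1, z 0 * (1 - z 1)] with hΦ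
  set Φ' : (Fin 2 → ℝ) → (Fin 2 → ℝ) →L[ℝ] (Fin 2 → ℝ) :=
    fun z => LinearMap.toContinuousLinearMap (Matrix.toLin' !![z 1, z 0; 1 - z 1, -(z 0)]) with hΦ'
  have hΦ0 : ∀ z, Φ z 0 = z 0 * z 1 := fun z => rfl
  have hΦ1 : ∀ z, Φ z 1 = z 0 * (1 - z 1) := fun z => rfl
  have hΦ'0 : ∀ z v : Fin 2 → ℝ, Φ' z v 0 = z 1 * v 0 + z 0 * v 1 := by
    intro z v
    change Matrix.toLin' !![z 1, z 0; 1 - z 1, -(z 0)] v 0 = _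
    rw [Matrix.toLin'_apply]
    simp [Matrix.mulVec, dotProduct, Fin.sum_univ_two]
  have hΦ'1 : ∀ z v : Fin 2 → ℝ, Φ' z v 1 = (1 - z 1) * v 0 + -(z 0) * v 1 := by
    intro z v
    change Matrix.toLin' !![z 1, z 0; 1 - z 1, -(z 0)] v 1 = _
    rw [Matrix.toLin'_apply]
    simp [Matrix.mulVec, dotProduct, Fin.sum_univ_two]
  have hdet : ∀ z, (Φ' z).det = -(z 0) := by
    intro z
    change LinearMap.det (Matrix.toLin' !![z 1, z 0; 1 - z 1, -(z 0)]) = _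
    rw [LinearMap.det_toLin', Matrix.det_fin_two_of]
    ring
  have hderiv : ∀ z, HasFDerivAt Φ (Φ' z) z := by
    intro z
    have h0 : HasFDerivAt (fun y : Fin 2 → ℝ => y 0)
        (ContinuousLinearMap.proj (R := ℝ) (φ := fun _ : Fin 2 => ℝ) 0) z := hasFDerivAt_apply 0 z
    have h1 : HasFDerivAt (fun y : Fin 2 → ℝ => y 1)
        (ContinuousLinearMap.proj (R := ℝ) (φ := fun _ : Fin 2 => ℝ) 1) z := hasFDerivAt_apply 1 z
    rw [hasFDerivAt_pi']
    refine Fin.forall_fin_two.mpr ⟨?_, ?_⟩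
    · have hf : (fun y : Fin 2 → ℝ => Φ y 0) = fun y => y 0 * y 1 := funext fun y => rfl
      rw [hf]
      refine (h0.mul h1).congr_fderiv (ContinuousLinearMap.ext fun v => ?_)
      simp [hΦ'0]
      ring
    · have hf : (fun y : Fin 2 → ℝ => Φ y 1) = fun y => y 0 * (1 - y 1) := funext fun y => rfl
      rw [hf]
      refine (h0.mul (h1.const_sub 1)).congr_fderiv (ContinuousLinearMap.ext fun v => ?_)
      simp [hΦ'1]
      ring
  refine ⟨Φ, Φ', hΦ0, hΦ1, hderiv, hdet, ?_, ?_⟩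
  · intro x hx y hy hxy
    have e0 := congrFun hxy 0
    have e1 := congrFun hxy 1
    simp only [hΦ0, hΦ1] at e0 e1
    have h0 : x 0 = y 0 := by linarith
    have h1 : x 1 = y 1 := by
      rw [h0] at e0
      exact mul_left_cancel₀ hy.1.ne' e0
    funext i
    fin_cases i
    · exact h0
    · exact h1
  · ext y
    constructor
    · rintro ⟨z, ⟨h0, h0t, h1⟩, rfl⟩
      simp only [mem_setOf_eq, hΦ0, hΦ1]
      refine ⟨mul_pos h0 h1.1, mul_pos h0 (sub_pos.2 h1.2), ?_⟩
      have e : z 0 * z 1 + z 0 * (1 - z 1) = z 0 := by ring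
      rw [e]
      exact h0t
    · rintro ⟨hy0, hy1, hy2⟩
      have hs : 0 < y 0 + y 1 := by linarith
      refine ⟨![y 0 + y 1, y 0 / (y 0 + y 1)], ⟨?_, ?_, ?_⟩, ?_⟩
      · change 0 < y 0 + y 1
        exact hs
      · change y 0 + y 1 < t
        exact hy2
      · change y 0 / (y 0 + y 1) ∈ Set.Ioo (0:ℝ) 1
        exact ⟨div_pos hy0 hs, by rw [div_lt_one hs]; linarith⟩
      · funext i
        fin_cases i
        · change (y 0 + y 1) * (y 0 / (y 0 + y 1)) = y 0
          field_simp
        · change (y 0 + y 1) * (1 - y 0 / (y 0 + y 1)) = y 1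
          field_simp
          ring

/-- **The Jacobian identity of the polar chart** for the exponents `-2/3, -2/3`: for `s > 0` and
`0 < u < 1`, `s^{-1/3} (u(1-u))^{-2/3} = (su)^{-2/3} (s(1-u))^{-2/3} · s`
(`(su)^e = s^e u^e` for nonnegative bases and `s^{-2/3} s^{-2/3} s = s^{-1/3}`). [folklore] -/
theorem jacobian_identity {s u : ℝ} (hs : 0 < s) (hu : 0 < u) (hu1 : u < 1) :
    s ^ (-(1:ℝ)/3) * (u * (1 - u)) ^ (-(2:ℝ)/3) =
      (s * u) ^ (-(2:ℝ)/3) * (s * (1 - u)) ^ (-(2:ℝ)/3) * s := by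
  have h1u : 0 < 1 - u := by linarith
  rw [Real.mul_rpow hs.le hu.le, Real.mul_rpow hs.le h1u.le, Real.mul_rpow hu.le h1u.le]
  have e : s ^ (-(1:ℝ)/3) = s ^ (-(2:ℝ)/3) * s ^ (-(2:ℝ)/3) * s := by
    rw [← Real.rpow_add hs, ← Real.rpow_add_one hs.ne']
    norm_num
  rw [e]
  ring

end BetaGammaTruncated

/-- **`BetaGammaTruncated`** (route WeightLine, stmt-KontsevichZagierPeriods-7183; stub
`betaGammaTruncated` of the line `Sketch` of `TateLifting`): for every rational level `t`, any
representation `r₁ = [{x > 0, y > 0, x + y < t}, x^{-2/3} y^{-2/3}]` is equivalent in the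
Kontsevich–Zagier calculus to any representation `r₂ = [{0 < s < t} × (0,1), s^{-1/3} (u(1-u))^{-2/3}]`
— by ONE change of variables along the Dirichlet polar chart `Φ(s,u) = (su, s(1-u))` of the truncated
simplex by the box (`|det DΦ| = s`; `[r₂] − [r₁] ∈ KZ.changeOfVariablesRel`), the levels `t ≤ 0` being
the empty case of the same move. [cite: KontsevichZagier2001, §1.2] -/
theorem tateLifting_betaGammaTruncated :
    ∀ (t : ℚ) (r₁ r₂ : KZ.IntegralRep 2), r₁.domain = {x | 0 < x 0 ∧ 0 < x 1 ∧ x 0 + x 1 < (t : ℝ)} → Set.EqOn r₁.integrand (fun x => (x 0) ^ (-(2:ℝ)/3) * (x 1) ^ (-(2:ℝ)/3)) r₁.domain → r₂.domain = {x | 0 < x 0 ∧ x 0 < (t : ℝ) ∧ x 1 ∈ Set.Ioo (0:ℝ) 1} → Set.EqOn r₂.integrand (fun x => (x 0) ^ (-(1:ℝ)/3) * (x 1 * (1 - x 1)) ^ (-(2:ℝ)/3)) r₂.domain → KZ.Equivalent r₁ r₂ := by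
  intro t r₁ r₂ h₁d h₁i h₂d h₂i
  obtain ⟨Φ, Φ', hΦ0, hΦ1, hderiv, hdet, hinj, himage⟩ :=
    BetaGammaTruncated.exists_polarChart (t : ℝ)
  -- the move `[r₂] − [r₁]`: source the box `r₂`, target the truncated simplex `r₁ = Φ(r₂)`
  have hmem : KZ.of r₂ - KZ.of r₁ ∈ KZ.changeOfVariablesRel := by
    refine ⟨2, r₂, r₁, Φ, Φ', ?_, fun x _ => (hderiv x).hasFDerivWithinAt,
      by rw [h₂d]; exact hinj, by rw [h₂d, h₁d, himage], fun z hz => ?_, rfl⟩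
    · -- `Φ` is a `ℚ`-polynomial map on the `ℚ`-semialgebraic set `r₂.domain`
      convert isSemialgebraicMapOn_aeval r₂.isSemialgebraic_domain
        ![MvPolynomial.X 0 * MvPolynomial.X 1, MvPolynomial.X 0 * (1 - MvPolynomial.X 1)]
        using 2 with z
      funext i
      fin_cases i
      · simp [hΦ0]
      · simp [hΦ1]
    · -- the Jacobian identity on the box
      have hz' : 0 < z 0 ∧ z 0 < (t : ℝ) ∧ z 1 ∈ Set.Ioo (0:ℝ) 1 := by rw [h₂d] at hz; exact hz
      have hΦz : Φ z ∈ r₁.domain := by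
        rw [h₁d, ← himage]
        exact mem_image_of_mem Φ hz'
      rw [h₂i hz, h₁i hΦz, hdet z, abs_neg, abs_of_pos hz'.1]
      simp only [hΦ0, hΦ1]
      exact BetaGammaTruncated.jacobian_identity hz'.1 hz'.2.2.1 hz'.2.2.2
  exact KZ.Equivalent.symm (KZ.changeOfVariablesRel_subset_relations hmem)

end Summit.KontsevichZagierPeriods.InverseLandau
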